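import Mathlib
import HarnessLib
import Literature.Analysis.FluidPDE.SelfSimilar
import Literature.Analysis.FluidPDE.VectorCalculus
import Literature.Analysis.FluidPDE.NSBoundedMildOseen
import Literature.Analysis.FluidPDE.SuitableWeak
import Literature.Analysis.FluidPDE.WeakSolution
import Literature.Analysis.FluidPDE.LocalTypeI
import Literature.Analysis.UnboundedOperators.HeatKernel
import Summits.NavierStokesRegularity.NavierStokesRegularity.Theorems.ChiralWindowDoorClassDerivDecay
import Summits.NavierStokesRegularity.NavierStokesRegularity.Theorems.FilamentPinchDoorFilamentaryGrowthStubSliceEnergyGrowth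
import Summits.NavierStokesRegularity.NavierStokesRegularity.Theorems.FilamentPinchDoorFilamentPinchLiouvilleWindowCalculus

/-!
# `FilamentPinchDoor.FilamentPinchLiouville` (stmt-NavierStokesRegularity-26430) — line `birth` (skeleton r2),
# stub `stub_frozenFlux` PROVED: the ENERGY-CLASS WINDOWED KELVIN LAW — the scale-normalised windowed
# circulation of a Type-I profile of the energy class is `K₂/L²`-Lipschitz in time

Registered stub of the skeleton of record (lead skeleton r2 of crux 26430, item evidence #3; planner ns-idea-6 g3
birth composition «window mass + frozen windowed circulation ⇒ pinch exclusion», stub statements unfolded, Gaussian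
window replaced by an arbitrary compactly supported window, Kelvin law in the sharp Lipschitz form), VERBATIM, so
the line's `sorry` at `stub_frozenFlux` closes by
`exact …Theorems.FilamentPinchDoorFilamentPinchLiouvilleStubFrozenFlux.stub_frozenFlux`.

STATEMENT.  For a profile `v` of the route's class (Type-I rate `C`, continuous on the open backward slab,
unit-viscosity Oseen-mild, divergence-free, suitable on the backward slab with a weak gradient and `𝐈 < ∞`), any
vector `e` and any smooth compactly supported window profile `φ`, there is `K₂` such that for all `L > 0`, `a ∈ ℝ³`
and `s < t < 0`,
`|L⁻¹∫⟪curl v(t,y), e⟫ φ((y−a)/L) dy − L⁻¹∫⟪curl v(s,y), e⟫ φ((y−a)/L) dy| ≤ K₂ (t − s)/L²`.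
(The sign and growth hypotheses of the crux are carried in the registered signature, not used.)

PROOF (velocity form; no enstrophy, no sign).
1. The class is classical on `(−∞,0)` with some smooth pressure (tree
   `…ChiralWindowDoorClassDerivDecay.exists_classical_of_class`), and the energy class has the slice Morrey bound
   `∫_{B(x,R)} ‖v(τ)‖² ≤ A·R` at EVERY `τ < 0` (stmt-26431's landed `stub_sliceEnergyGrowth`).
2. `∫ ⟪curl v, e⟫ φ_L = ∫ ⟪v, W_L⟫` with the divergence-free test field `W_L = curl(φ_L e) = ∇φ_L × e`
   (`integral_inner_curl_mul_window_eq`, tree `integral_mul_inner_curl_eq`; `div curl = 0`).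
3. `d/dτ ∫⟪v(τ), W_L⟫ = ∫ (⟪v, (v·∇)W_L⟫ + ⟪v, ΔW_L⟫)` (`hasDerivAt_integral_inner_test`: differentiation under the
   integral sign for jointly smooth fields against a compact support, tree `hasDerivAt_integral_of_support_subset`, and
   Leray's slice identity `IsClassicalNSSolutionOn.integral_inner_timeDerivWithin_test` — the pressure pairs to
   `−∫ q div W_L = 0`).
4. Parabolic rescaling (`laplacian_comp_invScale`, `testField_invScale`): `W_L(y) = L⁻¹ W₁((y−a)/L)`, so
   `‖DW_L‖ ≤ M₁/L²`, `‖ΔW_L‖ ≤ M₂/L³`, all supported in `K = B̄(a, R₀L)`; with `∫_K ‖v‖² ≤ 2|A|R₀L`,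
   `‖v‖ ≤ (L‖v‖² + L⁻¹)/2` and `|K| = c₃R₀³L³` the flux is `≤ M/L`,
   `M = 2M₁|A|R₀ + M₂(|A|R₀ + c₃R₀³/2)` (`abs_integral_flux_le`).
5. The mean value inequality on `[s,t] ⊂ (−∞,0)` and the normalisation `L⁻¹` give `K₂ = M`.
Scale check: `M₁, M₂, R₀` depend on `φ, e` only; `A = 𝐈.toReal`; everything is dimensionless.

HONEST FRAMING: a structural lemma about HYPOTHETICAL Type-I blow-up profiles of the energy class (the far-field
circulation of such a profile is frozen at scales `L ≫ √(t−s)`); it is sign-free and says nothing about the research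
stub `stub_pinchExclusion`; nothing here bears on Navier–Stokes regularity; no summit statement is proved.
-/

noncomputable section

-- the summit and its single sub-problem share the name (CONVENTIONS §1), as in every Theorems file
set_option linter.dupNamespace false

namespace Summit.NavierStokesRegularity.NavierStokesRegularity.Theorems.FilamentPinchDoorFilamentPinchLiouvilleStubFrozenFlux

open Set Function Filter MeasureTheory Metric Topology InnerProductSpace
open scoped ENNReal NNReal RealInnerProductSpace Laplacian ContDiff
open Literature.Analysis Literature.Analysis.FluidPDE
open Summit.NavierStokesRegularity.NavierStokesRegularity.Theorems.FilamentPinchDoorFilamentPinchLiouvilleWindowCalculus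

/-! ### The registered stub -/

section Main

/-- **Stub `stub_frozenFlux` of line `birth` (skeleton r1, crux `FilamentPinchLiouville`, stmt-26430), VERBATIM** —
the ENERGY-CLASS WINDOWED KELVIN LAW: for a profile of the route's class (Type-I rate, continuous, Oseen-mild,
divergence-free, suitable on the backward slab with `𝐈 < ∞`), any `e` and any smooth compactly supported window
profile `φ`, the scale-normalised windowed circulation `Ψ_L(a,τ) = L⁻¹ ∫ ⟪curl v(τ,y), e⟫ φ((y−a)/L) dy` is
`K₂/L²`-Lipschitz in `τ < 0`, uniformly in the centre `a` and the scale `L > 0`.  Proof: `Ψ_L = L⁻¹∫⟪v, W_L⟫` with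
the divergence-free `W_L = curl(φ_L e)`; `d/dτ ∫⟪v, W_L⟫ = ∫⟪v, (v·∇)W_L⟫ + ∫⟪v, ΔW_L⟫` (Leray's slice identity —
the pressure drops out); `‖DW_L‖ ≤ M₁/L²`, `‖ΔW_L‖ ≤ M₂/L³` (parabolic rescaling) and the slice Morrey bound
`∫_{B(a,2R₀L)} ‖v(τ)‖² ≤ 2|A|R₀L` of the energy class (stmt-26431's `stub_sliceEnergyGrowth`) give
`|d/dτ ∫⟪v,W_L⟫| ≤ M/L`; the mean value inequality on `[s,t]` concludes.  The sign and growth hypotheses are carried,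
not used. [cite: Leray1934, (17) p. 206; AlbrittonBarker2019, §1 after Thm 1.1] -/
theorem stub_frozenFlux : ∀ (C : ℝ) (v : ℝ → EuclideanSpace ℝ (Fin 3) → EuclideanSpace ℝ (Fin 3)) (π : ℝ → EuclideanSpace ℝ (Fin 3) → ℝ) (H : ℝ → EuclideanSpace ℝ (Fin 3) → EuclideanSpace ℝ (Fin 3) →L[ℝ] EuclideanSpace ℝ (Fin 3)), Literature.Analysis.FluidPDE.HasTypeITimeDecay C v → ContinuousOn (Function.uncurry v) (Set.Iio (0 : ℝ) ×ˢ Set.univ) → (∀ s t : ℝ, s < t → t < 0 → ∀ x, v t x = Literature.Analysis.UnboundedOperators.heatExtension (v s) (t - s) x - Literature.Analysis.FluidPDE.oseenDuhamel 1 s v v t x) → (∀ t < 0, Literature.Analysis.FluidPDE.VectorCalculus.IsDivFree (v t)) → Literature.Analysis.FluidPDE.IsSuitableWeakSolutionOn (Literature.Analysis.FluidPDE.slab (EuclideanSpace ℝ (Fin 3)) (Set.Iio (0 : ℝ)) isOpen_Iio) 1 0 v π → Literature.Analysis.FluidPDE.HasWeakSpatialGradientOn (Literature.Analysis.FluidPDE.slab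 (EuclideanSpace ℝ (Fin 3)) (Set.Iio (0 : ℝ)) isOpen_Iio) v H → Literature.Analysis.FluidPDE.typeIBound (Set.Iio (0 : ℝ) ×ˢ Set.univ) v π H < ⊤ → ∀ (e : EuclideanSpace ℝ (Fin 3)), e ≠ 0 → (∀ s < 0, ∀ y, 0 ≤ ⟪Literature.Analysis.FluidPDE.curl (v s) y, e⟫_ℝ) → (∃ K : ℝ, ∀ s < 0, ∀ (x : EuclideanSpace ℝ (Fin 3)) (R : ℝ), 0 < R → ∫⁻ y in Metric.ball x R, ENNReal.ofReal ⟪Literature.Analysis.FluidPDE.curl (v s) y, e⟫_ℝ ≤ ENNReal.ofReal (K * R)) → ∀ (φ : EuclideanSpace ℝ (Fin 3) → ℝ), ContDiff ℝ (⊤ : ℕ∞) φ → HasCompactSupport φ → ∃ K₂ : ℝ, ∀ L : ℝ, 0 < L → ∀ (a : EuclideanSpace ℝ (Fin 3)) (s t : ℝ), s < t → t < 0 → |(L⁻¹ * ∫ y, ⟪Literature.Analysis.FluidPDE.curl (v t) y, e⟫_ℝ * φ (L⁻¹ • (y - a))) - (L⁻¹ * ∫ y, ⟪Literature.Analysis.FluidPDE.curl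 (v s) y, e⟫_ℝ * φ (L⁻¹ • (y - a)))| ≤ K₂ * (t - s) / L ^ 2 := by
  intro C v π H hrate hcont hmild hdiv hsw hwg hI e _ _ _ φ hφ hφc
  -- (0) the class is classical on `(−∞,0)`; slice energy of the energy class
  obtain ⟨q, hcl⟩ :=
    Summit.NavierStokesRegularity.NavierStokesRegularity.Theorems.ChiralWindowDoorClassDerivDecay.exists_classical_of_class
      hrate hcont hmild hdiv
  obtain ⟨A, hA⟩ :=
    Summit.NavierStokesRegularity.NavierStokesRegularity.Theorems.FilamentPinchDoorFilamentaryGrowthStubSliceEnergyGrowth.stub_sliceEnergyGrowth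
      C v π H hrate hcont hmild hdiv hsw hwg hI
  have hS : IsOpen (Iio (0 : ℝ)) := isOpen_Iio
  -- (1) the window profile: support radius and the unscaled test field `W₁ = curl(φ e)`
  obtain ⟨R₁, hR₁⟩ := hφc.isCompact.isBounded.subset_ball (0 : (EuclideanSpace ℝ (Fin 3)))
  set R₀ : ℝ := max R₁ 1 with hR₀def
  have hR₀ : 0 < R₀ := lt_of_lt_of_le one_pos (le_max_right _ _)
  have hsuppφ : tsupport φ ⊆ ball (0 : (EuclideanSpace ℝ (Fin 3))) R₀ := hR₁.trans (ball_subset_ball (le_max_left _ _))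
  have hφd : Differentiable ℝ φ := hφ.differentiable (by simp)
  set W₁ : (EuclideanSpace ℝ (Fin 3)) → (EuclideanSpace ℝ (Fin 3)) := fun z => curlCLM ((fderiv ℝ φ z).smulRight e) with hW₁def
  have hW₁ : ContDiff ℝ ∞ W₁ := contDiff_testField hφ e
  have hW₁c : HasCompactSupport W₁ := hasCompactSupport_testField hφc e
  have hW₁2 : ContDiff ℝ 2 W₁ := hW₁.of_le (by norm_cast)
  have hDW₁c : Continuous (fderiv ℝ W₁) := hW₁.continuous_fderiv (by simp)
  obtain ⟨M₁, hM₁⟩ := (hW₁c.fderiv (𝕜 := ℝ)).exists_bound_of_continuous hDW₁c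
  have hΔW₁c : Continuous (Δ W₁) := continuous_laplacian hW₁2
  have hΔW₁s : HasCompactSupport (Δ W₁) :=
    HasCompactSupport.intro hW₁c fun z hz => laplacian_eq_zero_of_notMem_tsupport hz
  obtain ⟨M₂, hM₂⟩ := hΔW₁s.exists_bound_of_continuous hΔW₁c
  have hM₁0 : 0 ≤ M₁ := (norm_nonneg _).trans (hM₁ 0)
  have hM₂0 : 0 ≤ M₂ := (norm_nonneg _).trans (hM₂ 0)
  set c₃ : ℝ := (volume (ball (0 : (EuclideanSpace ℝ (Fin 3))) 1)).toReal with hc₃def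
  have hc₃0 : 0 ≤ c₃ := ENNReal.toReal_nonneg
  -- the constant
  set Mtot : ℝ := 2 * M₁ * |A| * R₀ + M₂ * (|A| * R₀ + R₀ ^ 3 * c₃ / 2) with hMdef
  refine ⟨Mtot, fun L hL a s t hst ht0 => ?_⟩
  have hs0 : s < 0 := hst.trans ht0
  -- (2) the scaled window and test field
  set φL : (EuclideanSpace ℝ (Fin 3)) → ℝ := fun y => φ (L⁻¹ • (y - a)) with hφLdef
  set W : (EuclideanSpace ℝ (Fin 3)) → (EuclideanSpace ℝ (Fin 3)) := fun y => curlCLM ((fderiv ℝ φL y).smulRight e) with hWdef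
  set K : Set (EuclideanSpace ℝ (Fin 3)) := closedBall a (R₀ * L) with hKdef
  have hK : IsCompact K := isCompact_closedBall a (R₀ * L)
  have hRL : 0 < R₀ * L := mul_pos hR₀ hL
  have hφL : ContDiff ℝ ∞ φL := contDiff_comp_invScale hφ L a
  -- off `K` the rescaled argument leaves the support of `φ`
  have hTK : ∀ y, y ∉ K → L⁻¹ • (y - a) ∉ tsupport φ := by
    intro y hy hmem
    have h1 := hsuppφ hmem
    rw [mem_ball, dist_zero_right, norm_smul, norm_inv, Real.norm_of_nonneg hL.le] at h1
    rw [hKdef, mem_closedBall, dist_eq_norm, not_le] at hy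
    rw [inv_mul_lt_iff₀ hL] at h1
    linarith
  have hφLK : ∀ y, y ∉ K → φL y = 0 := fun y hy => by
    show φ (L⁻¹ • (y - a)) = 0
    exact image_eq_zero_of_notMem_tsupport (hTK y hy)
  have hφLc : HasCompactSupport φL := HasCompactSupport.intro hK hφLK
  have hWeq : ∀ y, W y = L⁻¹ • W₁ (L⁻¹ • (y - a)) := fun y => testField_invScale hφd e L a y
  have hWeq' : W = fun y => L⁻¹ • W₁ (L⁻¹ • (y - a)) := funext hWeq
  have hW : ContDiff ℝ ∞ W := contDiff_testField hφL e
  have hW2 : ContDiff ℝ 2 W := hW.of_le (by norm_cast)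
  have hWK : ∀ y, y ∉ K → W y = 0 := by
    intro y hy
    rw [hWeq y, hW₁def]
    simp only [fderiv_of_notMem_tsupport ℝ (hTK y hy)]
    simp
  have hWc : HasCompactSupport W := HasCompactSupport.intro hK hWK
  have htsW : tsupport W ⊆ K :=
    closure_minimal (fun y hy => by by_contra h; exact hy (hWK y h)) isClosed_closedBall
  have hDK : ∀ y, y ∉ K → fderiv ℝ W y = 0 := fun y hy =>
    fderiv_of_notMem_tsupport ℝ fun h => hy (htsW h)
  have hΔK : ∀ y, y ∉ K → (Δ W) y = 0 := fun y hy =>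
    laplacian_eq_zero_of_notMem_tsupport fun h => hy (htsW h)
  have hdivW : VectorCalculus.IsDivFree W := fun y =>
    divergence_testField_eq_zero (hφL.of_le (by norm_cast)) e y
  -- (3) scale-invariant bounds on `DW` and `ΔW`
  have hW₁T : Differentiable ℝ fun y : (EuclideanSpace ℝ (Fin 3)) => W₁ (L⁻¹ • (y - a)) :=
    (contDiff_comp_invScale hW₁ L a).differentiable (by simp)
  have hD₁ : ∀ y, ‖fderiv ℝ W y‖ ≤ M₁ / L ^ 2 := by
    intro y
    rw [hWeq', fderiv_fun_const_smul (hW₁T y), fderiv_comp_invScale (hW₁.differentiable (by simp)) L a y,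
      norm_smul, norm_smul, norm_inv, Real.norm_of_nonneg hL.le]
    calc L⁻¹ * (L⁻¹ * ‖fderiv ℝ W₁ (L⁻¹ • (y - a))‖) ≤ L⁻¹ * (L⁻¹ * M₁) := by gcongr; exact hM₁ _
      _ = M₁ / L ^ 2 := by field_simp
  have hD₂ : ∀ y, ‖(Δ W) y‖ ≤ M₂ / L ^ 3 := by
    intro y
    have hsm : (fun y => L⁻¹ • W₁ (L⁻¹ • (y - a))) = L⁻¹ • (fun y => W₁ (L⁻¹ • (y - a))) := rfl
    have hcd : ContDiffAt ℝ 2 (fun y : (EuclideanSpace ℝ (Fin 3)) => W₁ (L⁻¹ • (y - a))) y :=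
      (contDiff_comp_invScale hW₁2 L a).contDiffAt
    rw [hWeq', hsm, laplacian_smul _ hcd, laplacian_comp_invScale hW₁2 L a y, norm_smul, norm_smul,
      norm_inv, Real.norm_of_nonneg hL.le, norm_pow, norm_inv, Real.norm_of_nonneg hL.le]
    calc L⁻¹ * (L⁻¹ ^ 2 * ‖(Δ W₁) (L⁻¹ • (y - a))‖) ≤ L⁻¹ * (L⁻¹ ^ 2 * M₂) := by gcongr; exact hM₂ _
      _ = M₂ / L ^ 3 := by field_simp
  -- (4) slice energy on `K ⊆ B(a, 2R₀L)` and the volume of `K`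
  have hKB : K ⊆ ball a (2 * R₀ * L) := by
    rw [hKdef]
    exact closedBall_subset_ball (by nlinarith)
  have hE : ∀ τ : ℝ, τ < 0 → ∫ y in K, ‖v τ y‖ ^ 2 ≤ |A| * (2 * R₀ * L) := fun τ hτ =>
    setIntegral_norm_sq_le_of_subset_ball (hcl.contDiff_velocity hτ).continuous (hA τ hτ)
      (by positivity) hKB
  have hvol : (volume K).toReal = (R₀ * L) ^ 3 * c₃ := by
    rw [hKdef, Measure.addHaar_closedBall volume a hRL.le, ENNReal.toReal_mul,
      ENNReal.toReal_ofReal (by positivity), finrank_euclideanSpace, Fintype.card_fin]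
  -- (5) the flux bound `|d/dτ ∫⟪v,W⟫| ≤ Mtot / L`
  have hflux : ∀ τ : ℝ, τ < 0 →
      |∫ y, (⟪v τ y, convect (v τ) W y⟫ + ⟪v τ y, (Δ W) y⟫)| ≤ Mtot / L := by
    intro τ hτ
    have h := abs_integral_flux_le (hcl.contDiff_velocity hτ).continuous hK hDK hΔK hD₁ hD₂
      (hE τ hτ) hL
    rw [hvol] at h
    refine h.trans (le_of_eq ?_)
    rw [hMdef]
    field_simp
  -- (6) mean value inequality for `F(τ) = ∫⟪v(τ), W⟫` on `[s, t]`
  set F : ℝ → ℝ := fun τ => ∫ y, ⟪v τ y, W y⟫ with hFdef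
  have hderiv : ∀ τ ∈ Icc s t, HasDerivWithinAt F
      (∫ y, (⟪v τ y, convect (v τ) W y⟫ + ⟪v τ y, (Δ W) y⟫)) (Icc s t) τ := fun τ hτ =>
    (hasDerivAt_integral_inner_test hcl hW hWc hdivW (lt_of_le_of_lt hτ.2 ht0)).hasDerivWithinAt
  have hbound : ∀ τ ∈ Ico s t,
      ‖∫ y, (⟪v τ y, convect (v τ) W y⟫ + ⟪v τ y, (Δ W) y⟫)‖ ≤ Mtot / L := fun τ hτ => by
    rw [Real.norm_eq_abs]
    exact hflux τ (hτ.2.trans ht0)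
  have hMVT := norm_image_sub_le_of_norm_deriv_le_segment' hderiv hbound t (right_mem_Icc.2 hst.le)
  rw [Real.norm_eq_abs] at hMVT
  -- (7) the windowed circulation is `L⁻¹ F`
  have hΨ : ∀ τ : ℝ, τ < 0 → ∫ y, ⟪curl (v τ) y, e⟫ * φ (L⁻¹ • (y - a)) = F τ := fun τ hτ =>
    integral_inner_curl_mul_window_eq ((hcl.contDiff_velocity hτ).of_le (by norm_cast))
      (hφL.of_le (by norm_cast)) hφLc e
  have key : |(L⁻¹ * ∫ y, ⟪curl (v t) y, e⟫ * φ (L⁻¹ • (y - a))) -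
      (L⁻¹ * ∫ y, ⟪curl (v s) y, e⟫ * φ (L⁻¹ • (y - a)))| = L⁻¹ * |F t - F s| := by
    rw [hΨ t ht0, hΨ s hs0, ← mul_sub, abs_mul, abs_inv, abs_of_pos hL]
  have fin : L⁻¹ * |F t - F s| ≤ Mtot * (t - s) / L ^ 2 :=
    calc L⁻¹ * |F t - F s| ≤ L⁻¹ * (Mtot / L * (t - s)) :=
          mul_le_mul_of_nonneg_left hMVT (inv_nonneg.2 hL.le)
      _ = Mtot * (t - s) / L ^ 2 := by field_simp
  exact key.trans_le fin

end Main

end Summit.NavierStokesRegularity.NavierStokesRegularity.Theorems.FilamentPinchDoorFilamentPinchLiouvilleStubFrozenFlux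

end
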